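import Summits.ResolutionOfSingularities.ResolutionOfSingularities.Theorems.EquisingularLiftEquisingularLiftNatNDRangeSubscheme
import Summits.ResolutionOfSingularities.ResolutionOfSingularities.Theorems.EquisingularLiftEquisingularLiftNatNDProjChart
import Summits.ResolutionOfSingularities.ResolutionOfSingularities.Theorems.EquisingularLiftEquisingularLiftNatNDProjChartStalk
import Summits.ResolutionOfSingularities.ResolutionOfSingularities.Theorems.EquisingularLiftEquisingularLiftNatResidueHypDefsND
import Literature.AlgebraicGeometry.Motives.ProjectiveSpaceDehomogenize
import Literature.AlgebraicGeometry.Motives.HypersurfaceFormsIrreducible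
import Literature.AlgebraicGeometry.Resolution.RegularLocalRingsQuotient
import Literature.AlgebraicGeometry.Resolution.ProjectiveSpaceRegular
import Mathlib.RingTheory.MvPolynomial.EulerIdentity
import HarnessLib

/-!
# [OURS · L1 W4.5(b) · EL♮(3)] DEAL «ND-K5», brick (B4γ) `ndInv_init` — sub-brick (γ6): at a NON-REGULAR point of `H` every partial
# derivative of the set-theoretic equation vanishes; and the stalk of the reduced structure on `ι(H)` through the chart (`…NatNDSingularGradient`)

Cell `res-hironaka`, crux EL♮(3) `EquisingularLiftNatThree` (stmt-ResolutionOfSingularities-20148), chain W4.5b, line `sections`.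
res-L1-w45b-nose-w1 g0 (WIDTH seat; owner of (B4γ) `ND.ndInv_init` after the desk's succession ruling 2026-08-28T14:56:41Z; sub-brick
(γ6) of res-type-027 g19's map `L/res-type-027/g19/B4g-FEASIBILITY.md` 1f63f2055c4d1e10).  OURS; NOT a statement of any manuscript; nothing
of [Hironaka2017] is asserted; AI-written kernel plumbing, weaker than expert review.  Def-free, `sorry`-free, standard axioms, no
instances.  `--kind proof --supports stmt-ResolutionOfSingularities-20148 --as helper`.

WHY (B4γ) NEEDS IT.  `IsoHypNDWon k n H ι` only speaks at points `a` with `F(a) = 0 ∧ ∇F(a) = 0`; to use it at a NON-REGULAR point `x₀` of `H`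
we must know `∇F(a) = 0` there (γ6).  And to read `ND.IsNDFrameAt`'s last clause we need the stalk `(𝓘_{closure (range ι)})_x` in terms
of the dehomogenised equation `f = F(xᵢ := 1)` through res-type-027's chart ring map `χ : k[t] → 𝒪_{ℙⁿ,x}` (`…NatNDProjChartStalk`
p643663): §2 gives `(𝓘)_x = (χ f)` as soon as `(χ f)` is radical (both ideals are radical with the same primes above them).

CONTENTS (namespace `…Cruxes.EquisingularLiftNat.Sections.ND`):
* §1 `algebraMap_notMem_maximalIdeal_sq_of_eval_pderiv_ne_zero` — a non-vanishing partial `∂ⱼf(b) ≠ 0` keeps `f` out of `𝔪²` in any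
  localisation at the rational point `b` (Leibniz, via tree `SmoothHypersurface.eval_pderiv_eq_zero_of_mem_sq`);
  `exists_eval_pderiv_dehomogenize_ne_zero` — Euler's identity dehomogenised: `∇F(a) ≠ 0`, `F(a) = 0`, `aᵢ = 1` ⇒ some `∂ⱼ(F(xᵢ:=1)) ≠ 0`.
* §2 ★ `stalkIdeal_vanishingIdeal_closure_range_eq_span` — `(𝓘_{closure (range ι)})_{chartι y₀} = (χ f)` when `(χ f)` is radical
  (`F` homogeneous of degree `> 0` with `V₊(F) = ι(H)`; `χ` with the stalk/support clauses of `ND.exists_chartRingHom`).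
* §3 ★★ `eval_pderiv_eq_zero_of_not_isRegularLocalRing` — (γ6): at a non-regular `x₀` with `ι x₀ = chartι y₀`, `∇F(a) = 0` (else `f ∉ 𝔪²`,
  `χ f` prime with regular quotient — tree `IsRegularLocalRing.prime_of_not_mem_sq` / `quotient_span_singleton` (Matsumura 14.2/14.3) —,
  `(𝓘)_x = (χ f)` by §2, `𝒪_{H,x₀} ≅ 𝒪_{ℙⁿ,x}/(χ f)` regular via p642906's `H ≅ 𝓘.subscheme`).

References (mathematics): H. Matsumura, *Commutative Ring Theory* (1986), Thms. 14.2, 14.3 [Matsumura1987]; R. Hartshorne, *Algebraic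
Geometry* (1977), I Ex. 5.8 (Euler's lemma), II Prop. 2.5 [Hartshorne1977].
-/

set_option linter.dupNamespace false

noncomputable section

open CategoryTheory AlgebraicGeometry TopologicalSpace IsLocalRing MvPolynomial
open AlgebraicGeometry.Scheme.IdealSheafData
open Literature.AlgebraicGeometry.Resolution
open Literature.AlgebraicGeometry.Motives

namespace Summit.ResolutionOfSingularities.ResolutionOfSingularities.Cruxes.EquisingularLiftNat.Sections.ND

open Summit.ResolutionOfSingularities.ResolutionOfSingularities.Cruxes.EquisingularLiftNat.Sections

variable (k : Type) [Field k] (n : ℕ)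

/-! ## §1 Algebra: the order of a polynomial at a rational point, read in a localisation -/

variable {k n} in
/-- **A non-vanishing partial derivative certifies order one, in any localisation at the point**: if `∂f/∂tⱼ (b) ≠ 0` then the image of
`f` in a localisation `S` of `k[t]` at the maximal ideal `Q` of the rational point `b` is not in `𝔪_S²` (Leibniz: a multiple `c·f` with
`c(b) ≠ 0` lying in `Q²` would have `∂ⱼ(c f)(b) = c(b)·∂ⱼf(b) = 0`). [folklore] -/
theorem algebraMap_notMem_maximalIdeal_sq_of_eval_pderiv_ne_zero {S : Type*} [CommRing S] [IsLocalRing S]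
    [Algebra (MvPolynomial (Fin n) k) S] (Q : Ideal (MvPolynomial (Fin n) k)) [Q.IsPrime] [IsLocalization.AtPrime S Q]
    (b : Fin n → k) (hQ : ∀ p, p ∈ Q ↔ MvPolynomial.eval b p = 0) {f : MvPolynomial (Fin n) k} (hf : MvPolynomial.eval b f = 0)
    {j : Fin n} (hj : MvPolynomial.eval b (pderiv j f) ≠ 0) :
    algebraMap (MvPolynomial (Fin n) k) S f ∉ (maximalIdeal S) ^ 2 := by
  intro hmem
  have hmax : maximalIdeal S = Q.map (algebraMap (MvPolynomial (Fin n) k) S) := by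
    rw [← IsLocalization.map_under Q.primeCompl S (maximalIdeal S)]
    congr 1
    exact IsLocalization.AtPrime.under_maximalIdeal (I := Q) S
  rw [hmax, ← Ideal.map_pow, IsLocalization.mem_map_algebraMap_iff Q.primeCompl] at hmem
  obtain ⟨⟨⟨a, ha⟩, ⟨s, hs⟩⟩, heq⟩ := hmem
  simp only at heq
  rw [← map_mul] at heq
  obtain ⟨⟨c, hc⟩, hc'⟩ := (IsLocalization.eq_iff_exists Q.primeCompl S).mp heq
  simp only at hc'
  -- `c * (f * s) = c * a ∈ Q²`, with `c, s ∉ Q`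
  have hmem2 : c * s * f ∈ RingHom.ker (MvPolynomial.eval b) ^ 2 := by
    have hker : RingHom.ker (MvPolynomial.eval b) = Q := by
      ext p; rw [RingHom.mem_ker, hQ]
    rw [hker, show c * s * f = c * (f * s) by ring, hc']
    exact Ideal.mul_mem_left _ c ha
  have h0 := SmoothHypersurface.eval_pderiv_eq_zero_of_mem_sq b j hmem2
  have hc0 : MvPolynomial.eval b c ≠ 0 := fun h => hc ((hQ c).mpr h)
  have hs0 : MvPolynomial.eval b s ≠ 0 := fun h => hs ((hQ s).mpr h)
  simp only [Derivation.leibniz, smul_eq_mul, map_add, map_mul, hf, zero_mul, add_zero, mul_eq_zero, hc0, hs0,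
    false_or] at h0
  exact hj h0

variable {k n} in
/-- **Euler's identity, dehomogenised**: for `F` homogeneous with `F(a) = 0`, `aᵢ = 1`, if SOME partial derivative of `F` is non-zero at
`a`, then some partial derivative of the dehomogenisation `F(xᵢ := 1)` is non-zero at the chart coordinates `(a_{i.succAbove j})ⱼ`
(Euler: `Σ aₗ ∂ₗF(a) = d·F(a) = 0`, so `∂ᵢF(a)` cannot be the only non-zero partial). [folklore] -/
theorem exists_eval_pderiv_dehomogenize_ne_zero {d : ℕ} {F : MvPolynomial (Fin (n + 1)) k} (hF : F.IsHomogeneous d)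
    (i : Fin (n + 1)) {a : Fin (n + 1) → k} (ha : a i = 1) (hFa : MvPolynomial.eval a F = 0)
    (hgrad : ∃ j, MvPolynomial.eval a (pderiv j F) ≠ 0) :
    ∃ j : Fin n, MvPolynomial.eval (fun l => a (i.succAbove l)) (pderiv j (ProjectiveSpace.dehomogenize k i F)) ≠ 0 := by
  by_contra hcon
  push Not at hcon
  have hsucc : ∀ j : Fin n, MvPolynomial.eval a (pderiv (i.succAbove j) F) = 0 := by
    intro j
    have := hcon j
    rwa [ProjectiveSpace.pderiv_dehomogenize, ProjectiveSpace.eval_dehomogenize i a ha] at this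
  -- Euler at `a`
  have heuler := congrArg (MvPolynomial.eval a) hF.sum_X_mul_pderiv
  rw [map_sum, Fin.sum_univ_succAbove _ i, map_nsmul, hFa, smul_zero] at heuler
  simp only [map_mul, MvPolynomial.eval_X, hsucc, mul_zero, Finset.sum_const_zero, add_zero, ha, one_mul] at heuler
  obtain ⟨j, hj⟩ := hgrad
  rcases Fin.eq_self_or_eq_succAbove i j with rfl | ⟨l, rfl⟩
  · exact hj heuler
  · exact hj (hsucc l)

/-! ## §2 The stalk of the reduced structure on `ι(H)` through the chart -/

variable {k n} in
/-- **The stalk ideal of the reduced structure on `ι(H) = V₊(F)` is `(f)·𝒪_{ℙⁿ,x}` as soon as `(f)·𝒪_{ℙⁿ,x}` is radical**, where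
`f = F(xᵢ := 1)` and `χ : k[t] → 𝒪_{ℙⁿ,x}` is the chart map of `…NatNDProjChartStalk` at `x = chartι y₀`: both ideals are radical and
are contained in the same primes of `𝒪_{ℙⁿ,x}` (a prime `Q ⊇ 𝓘_x` iff the point `comap Q` of the chart lies on `V₊(F)` iff `f ∈ comap Q`).
[OURS · (B4γ) plumbing] -/
theorem stalkIdeal_vanishingIdeal_closure_range_eq_span {H : Scheme.{0}} (ι : H ⟶ (projectiveSpace n k).left) [IsClosedImmersion ι]
    {d : ℕ} (hd : 0 < d) {F : MvPolynomial (Fin (n + 1)) k} (hF : F.IsHomogeneous d) (hZ : IsZeroSetOf k n H ι F)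
    (i : Fin (n + 1)) (y₀ : Spec (CommRingCat.of (MvPolynomial (Fin n) k)))
    (χ : MvPolynomial (Fin n) k →+* (projectiveSpace n k).left.presheaf.stalk (ProjectiveSpaceCells.chartι k n i y₀))
    (hχI : ∀ I : (projectiveSpace n k).left.IdealSheafData,
      stalkIdeal I (ProjectiveSpaceCells.chartι k n i y₀) =
        (((I.comap (ProjectiveSpaceCells.chartι k n i)).ideal ⟨⊤, isAffineOpen_top _⟩).comap
          (Scheme.ΓSpecIso (CommRingCat.of (MvPolynomial (Fin n) k))).inv.hom).map χ)
    (hχsupp : ∀ (I : (projectiveSpace n k).left.IdealSheafData) (y : Spec (CommRingCat.of (MvPolynomial (Fin n) k))),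
      ProjectiveSpaceCells.chartι k n i y ∈ I.support ↔
        ((I.comap (ProjectiveSpaceCells.chartι k n i)).ideal ⟨⊤, isAffineOpen_top _⟩).comap
          (Scheme.ΓSpecIso (CommRingCat.of (MvPolynomial (Fin n) k))).inv.hom ≤ y.asIdeal)
    (hrad : (Ideal.span {χ (ProjectiveSpace.dehomogenize k i F)}).IsRadical) :
    stalkIdeal (vanishingIdeal (⟨closure (Set.range ι), isClosed_closure⟩ : Closeds (projectiveSpace n k).left))
        (ProjectiveSpaceCells.chartι k n i y₀) =
      Ideal.span {χ (ProjectiveSpace.dehomogenize k i F)} := by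
  set J : (projectiveSpace n k).left.IdealSheafData :=
    vanishingIdeal (⟨closure (Set.range ι), isClosed_closure⟩ : Closeds (projectiveSpace n k).left) with hJ
  -- `J` and its stalk are radical
  have hJsupp : J.support = (⟨closure (Set.range ι), isClosed_closure⟩ : Closeds (projectiveSpace n k).left) :=
    SetLike.coe_injective (AlgebraicGeometry.Scheme.IdealSheafData.coe_support_vanishingIdeal _)
  have hJrad : J.radical = J := by
    have h := vanishingIdeal_support (I := J)
    rw [hJsupp] at h
    exact h.symm
  have hJA : (stalkIdeal J (ProjectiveSpaceCells.chartι k n i y₀)).IsRadical :=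
    Ideal.radical_eq_iff.mp (by rw [← stalkIdeal_radical, hJrad])
  -- the points of the chart on `ι(H)` are the zeros of `f`
  have hmemF : ∀ y : Spec (CommRingCat.of (MvPolynomial (Fin n) k)),
      ProjectiveSpaceCells.chartι k n i y ∈ J.support ↔ ProjectiveSpace.dehomogenize k i F ∈ y.asIdeal := by
    intro y
    rw [hJsupp]
    change (ProjectiveSpaceCells.chartι k n i y : (projectiveSpace n k).left) ∈ closure (Set.range ι) ↔ _
    rw [closure_range_eq_range ι]
    have hZ' := Set.ext_iff.mp hZ (ProjectiveSpaceCells.chartι k n i y)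
    exact hZ'.trans (mem_asHomogeneousIdeal_chartι_iff k n i hd ((MvPolynomial.mem_homogeneousSubmodule d F).mpr hF) y)
  -- primes over the stalk ideal are the primes containing `χ f`
  have hkey : ∀ Q : Ideal ((projectiveSpace n k).left.presheaf.stalk (ProjectiveSpaceCells.chartι k n i y₀)), Q.IsPrime →
      (stalkIdeal J (ProjectiveSpaceCells.chartι k n i y₀) ≤ Q ↔ Ideal.span {χ (ProjectiveSpace.dehomogenize k i F)} ≤ Q) := by
    intro Q hQ
    rw [hχI J, Ideal.map_le_iff_le_comap, Ideal.span_singleton_le_iff_mem]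
    exact ((hχsupp J ⟨Q.comap χ, Ideal.IsPrime.comap χ⟩).symm.trans (hmemF ⟨Q.comap χ, Ideal.IsPrime.comap χ⟩))
  -- two radical ideals with the same primes over them coincide
  rw [← hJA.radical, ← hrad.radical, Ideal.radical_eq_sInf, Ideal.radical_eq_sInf]
  congr 1
  ext Q
  constructor
  · rintro ⟨hle, hQ⟩; exact ⟨(hkey Q hQ).mp hle, hQ⟩
  · rintro ⟨hle, hQ⟩; exact ⟨(hkey Q hQ).mpr hle, hQ⟩

/-! ## §3 (γ6): at a non-regular point of `H` every partial derivative of the set-theoretic equation vanishes -/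

variable {k n} in
/-- **(γ6) `eval_pderiv_eq_zero_of_not_isRegularLocalRing`** — let `ι : H ⟶ ℙⁿ_k` be a closed immersion from a reduced scheme,
`F` homogeneous of degree `d > 0` with `V₊(F) = ι(H)` as a set (`IsZeroSetOf`), `x₀ ∈ H` a NON-REGULAR point whose image is the point
`chartι y₀` of the `i`-th chart with `aᵢ = 1` and `𝔭_{y₀}` the ideal of the rational point `(a_{i.succAbove j})ⱼ`.  Then `∇F(a) = 0`.
For if some `∂ⱼF(a) ≠ 0`, then (Euler) some partial of `f = F(xᵢ := 1)` is non-zero at the point, so `f ∉ 𝔪²_{ℙⁿ,x}`; in the regular local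
ring `𝒪_{ℙⁿ,x}` the element `f` is then prime with regular quotient (Matsumura 14.2/14.3), `(f)` is the stalk of the reduced structure on
`ι(H)` (`stalkIdeal_vanishingIdeal_closure_range_eq_span`), and `𝒪_{H,x₀} ≅ 𝒪_{ℙⁿ,x}/(f)` would be regular. [OURS · (B4γ) sub-brick (γ6)] -/
theorem eval_pderiv_eq_zero_of_not_isRegularLocalRing {H : Scheme.{0}} (ι : H ⟶ (projectiveSpace n k).left) [IsClosedImmersion ι]
    [IsReduced H] {x₀ : H} (hx₀ : ¬ IsRegularLocalRing (H.presheaf.stalk x₀))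
    {d : ℕ} (hd : 0 < d) {F : MvPolynomial (Fin (n + 1)) k} (hF : F.IsHomogeneous d) (hZ : IsZeroSetOf k n H ι F)
    (i : Fin (n + 1)) {a : Fin (n + 1) → k} (ha : a i = 1) (y₀ : Spec (CommRingCat.of (MvPolynomial (Fin n) k)))
    (hy₀ : ∀ p, p ∈ y₀.asIdeal ↔ MvPolynomial.eval (fun j => a (i.succAbove j)) p = 0)
    (hx : ProjectiveSpaceCells.chartι k n i y₀ = ι x₀) :
    ∀ j, MvPolynomial.eval a (pderiv j F) = 0 := by
  -- `F ∈ 𝔭_x`, hence `f := F(xᵢ := 1) ∈ 𝔭_{y₀}` and `F(a) = 0`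
  have hmemZ : ProjectiveSpaceCells.chartι k n i y₀ ∈ Set.range ι.base := by rw [hx]; exact ⟨x₀, rfl⟩
  have hFmem := (Set.ext_iff.mp hZ (ProjectiveSpaceCells.chartι k n i y₀)).mp hmemZ
  have hfy₀ : ProjectiveSpace.dehomogenize k i F ∈ y₀.asIdeal :=
    (mem_asHomogeneousIdeal_chartι_iff k n i hd ((MvPolynomial.mem_homogeneousSubmodule d F).mpr hF) y₀).mp hFmem
  have hfb : MvPolynomial.eval (fun j => a (i.succAbove j)) (ProjectiveSpace.dehomogenize k i F) = 0 := (hy₀ _).mp hfy₀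
  have hFa : MvPolynomial.eval a F = 0 := by
    rw [← ProjectiveSpace.eval_dehomogenize i a ha F]; exact hfb
  by_contra hcon
  push Not at hcon
  obtain ⟨j, hj⟩ := exists_eval_pderiv_dehomogenize_ne_zero hF i ha hFa hcon
  -- the chart ring map `χ : k[t] → A := 𝒪_{ℙⁿ,x}`
  obtain ⟨χ, hloc, -, hχI, hχsupp⟩ := exists_chartRingHom k n i y₀
  letI := χ.toAlgebra
  haveI : IsLocalization.AtPrime ((projectiveSpace n k).left.presheaf.stalk (ProjectiveSpaceCells.chartι k n i y₀)) y₀.asIdeal := hloc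
  haveI : IsRegularLocalRing ((projectiveSpace n k).left.presheaf.stalk (ProjectiveSpaceCells.chartι k n i y₀)) :=
    isRegular_projectiveSpace n k _
  have hmem : χ (ProjectiveSpace.dehomogenize k i F) ∈
      maximalIdeal ((projectiveSpace n k).left.presheaf.stalk (ProjectiveSpaceCells.chartι k n i y₀)) :=
    (IsLocalization.AtPrime.to_map_mem_maximal_iff _ y₀.asIdeal _).mpr hfy₀
  have hnot : χ (ProjectiveSpace.dehomogenize k i F) ∉
      (maximalIdeal ((projectiveSpace n k).left.presheaf.stalk (ProjectiveSpaceCells.chartι k n i y₀))) ^ 2 :=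
    algebraMap_notMem_maximalIdeal_sq_of_eval_pderiv_ne_zero y₀.asIdeal (fun j => a (i.succAbove j)) hy₀ hfb hj
  -- `(f)·A` is prime, hence radical, hence the stalk of the reduced structure on `ι(H)`; and `A/(f)` is regular
  have hprime : Prime (χ (ProjectiveSpace.dehomogenize k i F)) := IsRegularLocalRing.prime_of_not_mem_sq hmem hnot
  have hrad : (Ideal.span {χ (ProjectiveSpace.dehomogenize k i F)}).IsRadical :=
    ((Ideal.span_singleton_prime hprime.ne_zero).mpr hprime).isRadical
  have hstalk := stalkIdeal_vanishingIdeal_closure_range_eq_span ι hd hF hZ i y₀ χ hχI hχsupp hrad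
  have hregq := (IsRegularLocalRing.quotient_span_singleton hmem hnot).1
  -- transport to `H` through `H ≅ (𝓘_{closure (range ι)}).subscheme`
  obtain ⟨e, he⟩ := exists_iso_subscheme_vanishingIdeal_closure_range ι
  have hpt : (vanishingIdeal (⟨closure (Set.range ι), isClosed_closure⟩ : Closeds (projectiveSpace n k).left)).subschemeι
      (e.hom x₀) = ProjectiveSpaceCells.chartι k n i y₀ := by
    rw [← Scheme.Hom.comp_apply, he, hx]
  have hregT : IsRegularLocalRing ((vanishingIdeal (⟨closure (Set.range ι), isClosed_closure⟩ :
      Closeds (projectiveSpace n k).left)).subscheme.presheaf.stalk (e.hom x₀)) := by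
    rw [isRegularLocalRing_stalk_subscheme_iff, hpt, hstalk]
    exact hregq
  exact hx₀ ((isRegularLocalRing_stalk_iff_of_iso e x₀).mp hregT)

end Summit.ResolutionOfSingularities.ResolutionOfSingularities.Cruxes.EquisingularLiftNat.Sections.ND

end
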